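import Mathlib
import HarnessLib
import Literature.Probability.Percolation.SitePaths
import Literature.Probability.Percolation.SharpnessDCTProofs
import Literature.Probability.Percolation.UniformPercolation
import Literature.Probability.Percolation.GMFiniteSize
import Literature.Probability.Percolation.FiniteEnergy
import Literature.Barriers.CriticalPhenomena.KozmaNachmiasLemma31
import Literature.Barriers.CriticalPhenomena.SpanningClustersAboveSix

/-!
# `stub_critCrossing` of line `Sketch` (crux `BudgetTightness`, stmt-CriticalPhenomena-5248):
# critical aspect-2 annuli of `ℤ³` are crossed with probability bounded away from `0`

`∃ ε > 0, ∀ m ≥ 1, P_{p_c}(B(m) ↔ ∂ⁱⁿB(2m) in B(2m)) ≥ ε` (the event is `annulusCrossing 3 m`), by the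
finite-size criterion: (A) `P_{p_c}(0 ↔ ∂ⁱⁿB(r) in B(r)) ≥ 1/(36(2r+1)²)` from `φ_{p_c}(B(r)) ≥ 1`
(`sum_sphere_real_openConnIn_ge`); (B) `u(8m) ≤ K u(m)²` for `u(m) = P(annulusCrossing 3 m)`: a crossing of
`B(8m) → ∂ⁱⁿB(16m)` crosses two translated annuli `c + (B(m) → ∂ⁱⁿB(2m))`, `c ∈ (2m+1)ℤ³`, one around
its starting point (`‖c‖ ≤ 9m`) and one around its endpoint (`‖c‖ ≥ 15m`), which are independent
(`bondPercolation_real_inter_of_disjoint`) and have probability `u(m)` (`real_shiftLinkEvent_eq`);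
(C) if `K u(m) < 1/128` then `K u(8^j m) ≤ (1/128)^{j+1}`, contradicting (A).
-/

noncomputable section

namespace Summit.CriticalPhenomena.PercolationContinuityZ3.Theorems.BudgetTightness

open MeasureTheory ProbabilityTheory
open Literature.Probability.Percolation Literature.Probability.LatticeModels
open Literature.Probability.Percolation.DCT16 Literature.Barriers.CriticalPhenomena

namespace StubCritCrossing

/-! ### (A) The polynomial one-arm lower bound at `p_c` -/

/-- `1 ≤ 36 (2r+1)² · P_{p_c}(0 ↔ ∂ⁱⁿB(r) in B(r))` on `ℤ³` (from `φ_{p_c}(B(r)) ≥ 1`). -/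
theorem one_le_mul_real_siteToBoundary (r : ℕ) :
    1 ≤ 36 * (2 * r + 1 : ℝ) ^ 2 *
      (bondPercolation (zdGraph 3) (criticalProbI 3)).real (siteToBoundary 3 r) := by
  have h := sum_sphere_real_openConnIn_ge (d := 3) (by norm_num) (criticalProbI 3)
    (coe_criticalProbI 3).symm.le r
  rw [sphere_eq_innerBoundary (by norm_num)] at h
  have hle : ∑ z ∈ innerBoundary (zdGraph 3) (box 3 r),
      (bondPercolation (zdGraph 3) (criticalProbI 3)).real
        (openConnIn (↑(box 3 r) : Set (Site 3)) 0 z) ≤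
      (innerBoundary (zdGraph 3) (box 3 r)).card *
        (bondPercolation (zdGraph 3) (criticalProbI 3)).real (siteToBoundary 3 r) := by
    rw [← nsmul_eq_mul, ← Finset.sum_const]
    exact Finset.sum_le_sum fun z hz => measureReal_mono fun ω hω => ⟨z, hz, hω⟩
  have hcard : ((innerBoundary (zdGraph 3) (box 3 r)).card : ℝ) ≤ 6 * (2 * r + 1) ^ 2 := by
    have := card_innerBoundary_box_le (d := 3) r
    norm_num at this
    exact_mod_cast this
  norm_num at h
  nlinarith [hle.trans (mul_le_mul_of_nonneg_right hcard measureReal_nonneg)]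

/-- `1 ≤ 900 n² · u(n)` for `n ≥ 1`, `u(n) = P_{p_c}(annulusCrossing 3 n)`. -/
theorem one_le_mul_real_annulusCrossing {n : ℕ} (hn : 1 ≤ n) :
    1 ≤ 900 * (n : ℝ) ^ 2 *
      (bondPercolation (zdGraph 3) (criticalProbI 3)).real (annulusCrossing 3 n) := by
  have h1 := one_le_mul_real_siteToBoundary (2 * n)
  have h2 : (bondPercolation (zdGraph 3) (criticalProbI 3)).real (siteToBoundary 3 (2 * n)) ≤
      (bondPercolation (zdGraph 3) (criticalProbI 3)).real (annulusCrossing 3 n) :=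
    measureReal_mono fun ω h => ⟨0, zero_mem_box 3 n, h⟩
  have hn' : (1 : ℝ) ≤ n := by exact_mod_cast hn
  have h3 : 36 * (2 * ((2 * n : ℕ) : ℝ) + 1) ^ 2 ≤ 900 * (n : ℝ) ^ 2 := by push_cast; nlinarith
  nlinarith [h3, measureReal_nonneg (μ := bondPercolation (zdGraph 3) (criticalProbI 3))
    (s := siteToBoundary 3 (2 * n))]

/-! ### (B) Geometry: the net of centres and the two translated annuli -/

/-- Rounding one coordinate to the net `(2m+1)ℤ`: `|t| ≤ B`, `B + m < (R+1)(2m+1)` give `k` with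
`|k| ≤ R` and `|t - (2m+1)k| ≤ m`. -/
theorem exists_round (m R B : ℕ) (hB : (B : ℤ) + m < (R + 1) * (2 * m + 1)) {t : ℤ}
    (ht : -(B : ℤ) ≤ t ∧ t ≤ B) :
    ∃ k : ℤ, (-(R : ℤ) ≤ k ∧ k ≤ R) ∧
      (-(m : ℤ) ≤ t - (2 * m + 1) * k ∧ t - (2 * m + 1) * k ≤ m) := by
  obtain ⟨k, hk⟩ : ∃ k : ℤ, (t + m) / (2 * m + 1) = k := ⟨_, rfl⟩
  have h1 : (t + m) % (2 * m + 1) + (2 * m + 1) * k = t + m := by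
    rw [← hk]; exact Int.emod_add_mul_ediv _ _
  have h2 := Int.emod_nonneg (t + m) (show (2 * (m : ℤ) + 1) ≠ 0 by omega)
  have h3 := Int.emod_lt_of_pos (t + m) (show (0 : ℤ) < 2 * m + 1 by omega)
  have hN : (0 : ℤ) ≤ 2 * m + 1 := by omega
  have hlo : t - m ≤ (2 * m + 1) * k := by omega
  have hhi : (2 * m + 1) * k ≤ t + m := by omega
  refine ⟨k, ⟨?_, ?_⟩, by omega, by omega⟩
  · by_contra h
    have := mul_le_mul_of_nonneg_left (show k ≤ -(R + 1) by omega) hN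
    nlinarith
  · by_contra h
    have := mul_le_mul_of_nonneg_left (show (R : ℤ) + 1 ≤ k by omega) hN
    nlinarith

/-- The net `(2m+1)·B(R)` covers `B(B)` by boxes of radius `m` when `B + m < (R+1)(2m+1)`. -/
theorem exists_centre {m R B : ℕ} (hB : (B : ℤ) + m < (R + 1) * (2 * m + 1)) {z : Site 3}
    (hz : z ∈ box 3 B) :
    ∃ k ∈ box 3 R, z - (fun i => (2 * (m : ℤ) + 1) * k i) ∈ box 3 m := by
  rw [mem_box] at hz
  choose k hk hk' using fun i => exists_round m R B hB (hz i)
  exact ⟨k, mem_box.2 hk, mem_box.2 fun i => by simpa using hk' i⟩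

/-- **Crossing a translated annulus.** An open lattice path from `b ∈ c + B(m)` to a point outside
`c + B(2m)` puts `ω` in the translate by `c` of `annulusCrossing 3 m` (first exit from `c + B(2m)`). -/
theorem mem_shiftLinkEvent_of_pathIn {m : ℕ} {ω : BondConfig (Site 3)}
    (hω : ω ⊆ (zdGraph 3).edgeSet) {A : Set (Site 3)} {b z c : Site 3}
    (hp : PathIn (openGraph ω) A b z) (hb : b - c ∈ box 3 m) (hz : z - c ∉ box 3 (2 * m)) :
    ω ∈ shiftLinkEvent (box 3 m) (innerBoundary (zdGraph 3) (box 3 (2 * m))) (2 * m) c := by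
  have hR : (fun w => w + c) '' (↑(box 3 (2 * m)) : Set (Site 3)) =
      {w : Site 3 | w - c ∈ box 3 (2 * m)} := by
    rw [setOf_sub_mem_box_eq, Finset.coe_image]
  have hbR : b ∈ {w : Site 3 | w - c ∈ box 3 (2 * m)} := box_subset_box_two_mul 3 m hb
  obtain ⟨a, a', ha, ha', -, hadj, hpa⟩ := hp.exit hbR hz
  refine ⟨b - c, hb, a - c, ?_, ?_⟩
  · rw [mem_innerBoundary_iff]
    refine ⟨ha, a' - c, ha', (zdGraph_adj_shift_iff c (a - c) (a' - c)).1 ?_⟩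
    simpa using adj_of_openGraph_adj hω hadj
  · rw [sub_add_cancel, sub_add_cancel, hR]
    exact mem_openConnIn_of_pathIn (hpa.mono Set.inter_subset_left)

/-- The translated crossing event is determined by the pairs of the translated box `c + B(n)`. -/
theorem determinedBy_shiftLinkEvent (S T : Finset (Site 3)) (n : ℕ) (c : Site 3) :
    DeterminedBy (shiftLinkEvent S T n c) ({w : Site 3 | w - c ∈ box 3 n}.sym2) := by
  have hR : (fun w => w + c) '' (↑(box 3 n) : Set (Site 3)) = {w : Site 3 | w - c ∈ box 3 n} := by
    rw [setOf_sub_mem_box_eq, Finset.coe_image]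
  rw [determinedBy_iff]
  intro ω ω' h
  simp only [shiftLinkEvent, Set.mem_setOf_eq, hR]
  exact exists_congr fun y => and_congr_right fun _ => exists_congr fun x =>
    and_congr_right fun _ =>
      (determinedBy_iff _ _).1 (determinedBy_openConnIn _ _ _ subset_rfl) ω ω' h

/-- The translated crossing event is measurable. -/
theorem measurableSet_shiftLinkEvent (S T : Finset (Site 3)) (n : ℕ) (c : Site 3) :
    MeasurableSet (shiftLinkEvent S T n c) := by
  have : shiftLinkEvent S T n c = ⋃ y ∈ S, ⋃ x ∈ T,
      openConnIn (↑((box 3 n).image (· + c)) : Set (Site 3)) (y + c) (x + c) := by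
    ext ω
    simp only [shiftLinkEvent, Finset.coe_image, Set.mem_setOf_eq, Set.mem_iUnion, exists_prop]
  rw [this]
  exact Finset.measurableSet_biUnion _ fun y _ =>
    Finset.measurableSet_biUnion _ fun x _ => measurableSet_openConnIn _ _ _

/-- Translation invariance: the translated annulus is crossed with probability `u(m)`. -/
theorem real_shiftLinkEvent (p : unitInterval) (m : ℕ) (c : Site 3) :
    (bondPercolation (zdGraph 3) p).real
        (shiftLinkEvent (box 3 m) (innerBoundary (zdGraph 3) (box 3 (2 * m))) (2 * m) c) =
      (bondPercolation (zdGraph 3) p).real (annulusCrossing 3 m) :=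
  real_shiftLinkEvent_eq p _ _ _ c

/-- Independence: two translated annuli with far-apart centres are crossed simultaneously with
probability `u(m)²`. -/
theorem real_inter_shiftLinkEvent (p : unitInterval) {m : ℕ} {c₁ c₂ : Site 3}
    (h : c₂ - c₁ ∉ box 3 (2 * (2 * m))) :
    (bondPercolation (zdGraph 3) p).real
        (shiftLinkEvent (box 3 m) (innerBoundary (zdGraph 3) (box 3 (2 * m))) (2 * m) c₁ ∩
          shiftLinkEvent (box 3 m) (innerBoundary (zdGraph 3) (box 3 (2 * m))) (2 * m) c₂) =
      (bondPercolation (zdGraph 3) p).real (annulusCrossing 3 m) ^ 2 := by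
  rw [sq, bondPercolation_real_inter_of_disjoint (zdGraph 3) p (disjoint_sym2_shiftedBox h)
    (determinedBy_shiftLinkEvent _ _ _ c₁) (determinedBy_shiftLinkEvent _ _ _ c₂)
    (measurableSet_shiftLinkEvent _ _ _ c₁) (measurableSet_shiftLinkEvent _ _ _ c₂),
    real_shiftLinkEvent, real_shiftLinkEvent]

/-- **Routing.** A crossing `B(8m) → ∂ⁱⁿB(16m)` (lattice configuration, `m ≥ 1`) crosses a translated
annulus centred at `(2m+1)k₁ ∈ B(9m)`, `k₁ ∈ B(4)`, and one centred at `(2m+1)k₂ ∉ B(14m)`, `k₂ ∈ B(8)`. -/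
theorem mem_biUnion_of_mem_annulusCrossing {m : ℕ} (hm : 1 ≤ m) {ω : BondConfig (Site 3)}
    (hω : ω ⊆ (zdGraph 3).edgeSet) (h : ω ∈ annulusCrossing 3 (8 * m)) :
    ω ∈ ⋃ k₁ ∈ (box 3 4).filter
        (fun k : Site 3 => (fun i => (2 * (m : ℤ) + 1) * k i) ∈ box 3 (9 * m)),
      ⋃ k₂ ∈ (box 3 8).filter
        (fun k : Site 3 => (fun i => (2 * (m : ℤ) + 1) * k i) ∉ box 3 (14 * m)),
        shiftLinkEvent (box 3 m) (innerBoundary (zdGraph 3) (box 3 (2 * m))) (2 * m)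
            (fun i => (2 * (m : ℤ) + 1) * k₁ i) ∩
          shiftLinkEvent (box 3 m) (innerBoundary (zdGraph 3) (box 3 (2 * m))) (2 * m)
            (fun i => (2 * (m : ℤ) + 1) * k₂ i) := by
  obtain ⟨x, hx, y, hy, hxy⟩ := h
  have hp := mem_openConnIn_iff_pathIn.1 hxy
  have hyb : y ∈ box 3 (2 * (8 * m)) := (mem_innerBoundary_iff.1 hy).1
  obtain ⟨i, hi⟩ := exists_eq_of_mem_innerBoundary_box hy
  obtain ⟨k₁, hk₁, hxk₁⟩ := exists_centre (m := m) (R := 4) (B := 8 * m) (by push_cast; omega) hx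
  obtain ⟨k₂, hk₂, hyk₂⟩ :=
    exists_centre (m := m) (R := 8) (B := 2 * (8 * m)) (by push_cast; omega) hyb
  have hx' := mem_box.1 hx
  have hxk₁' := mem_box.1 hxk₁
  have hyk₂' := mem_box.1 hyk₂
  simp only [Pi.sub_apply] at hxk₁' hyk₂'
  push_cast at hi hx' hxk₁' hyk₂'
  have hc₁ : (fun i => (2 * (m : ℤ) + 1) * k₁ i) ∈ box 3 (9 * m) := by
    rw [mem_box]; intro j; have := hx' j; have := hxk₁' j; push_cast; constructor <;> omega
  have hc₂ : (fun i => (2 * (m : ℤ) + 1) * k₂ i) ∉ box 3 (14 * m) := by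
    rw [mem_box]; intro hc; have := hc i; have := hyk₂' i; omega
  have hy₁ : y - (fun i => (2 * (m : ℤ) + 1) * k₁ i) ∉ box 3 (2 * m) := by
    rw [mem_box]; intro hc; have h := hc i; have := hx' i; have := hxk₁' i
    simp only [Pi.sub_apply] at h; push_cast at h; omega
  have hx₂ : x - (fun i => (2 * (m : ℤ) + 1) * k₂ i) ∉ box 3 (2 * m) := by
    rw [mem_box]; intro hc; have h := hc i; have := hx' i; have := hyk₂' i
    simp only [Pi.sub_apply] at h; push_cast at h; omega
  refine Set.mem_iUnion₂.2 ⟨k₁, Finset.mem_filter.2 ⟨hk₁, hc₁⟩, Set.mem_iUnion₂.2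
    ⟨k₂, Finset.mem_filter.2 ⟨hk₂, hc₂⟩, mem_shiftLinkEvent_of_pathIn hω hp hxk₁ hy₁,
      mem_shiftLinkEvent_of_pathIn hω hp.symm hyk₂ hx₂⟩⟩

/-- **Renormalisation inequality** `u(8m) ≤ 9³ · 17³ · u(m)²` (`m ≥ 1`, every `p`). -/
theorem real_annulusCrossing_eight_mul_le (p : unitInterval) {m : ℕ} (hm : 1 ≤ m) :
    (bondPercolation (zdGraph 3) p).real (annulusCrossing 3 (8 * m)) ≤
      729 * 4913 * (bondPercolation (zdGraph 3) p).real (annulusCrossing 3 m) ^ 2 := by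
  set F₁ := (box 3 4).filter
    (fun k : Site 3 => (fun i => (2 * (m : ℤ) + 1) * k i) ∈ box 3 (9 * m)) with hF₁
  set F₂ := (box 3 8).filter
    (fun k : Site 3 => (fun i => (2 * (m : ℤ) + 1) * k i) ∉ box 3 (14 * m)) with hF₂
  set T : Site 3 → Set (BondConfig (Site 3)) := fun c =>
    shiftLinkEvent (box 3 m) (innerBoundary (zdGraph 3) (box 3 (2 * m))) (2 * m) c with hT
  have h1 : ((F₁.card : ℕ) : ℝ) ≤ 729 := by
    have : F₁.card ≤ (box 3 4).card := Finset.card_filter_le _ _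
    rw [card_box] at this
    exact_mod_cast this
  have h2 : ((F₂.card : ℕ) : ℝ) ≤ 4913 := by
    have : F₂.card ≤ (box 3 8).card := Finset.card_filter_le _ _
    rw [card_box] at this
    exact_mod_cast this
  have hfar : ∀ k₁ ∈ F₁, ∀ k₂ ∈ F₂, (fun i => (2 * (m : ℤ) + 1) * k₂ i) -
      (fun i => (2 * (m : ℤ) + 1) * k₁ i) ∉ box 3 (2 * (2 * m)) := by
    intro k₁ hk₁ k₂ hk₂ hc
    obtain ⟨-, hc₁⟩ := Finset.mem_filter.1 hk₁
    obtain ⟨-, hc₂⟩ := Finset.mem_filter.1 hk₂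
    refine hc₂ (mem_box.2 fun j => ?_)
    have h₁ := (mem_box.1 hc₁) j
    have h := (mem_box.1 hc) j
    simp only [Pi.sub_apply] at h
    push_cast at h h₁ ⊢
    constructor <;> omega
  calc (bondPercolation (zdGraph 3) p).real (annulusCrossing 3 (8 * m))
      ≤ (bondPercolation (zdGraph 3) p).real (⋃ k₁ ∈ F₁, ⋃ k₂ ∈ F₂,
          T (fun i => (2 * (m : ℤ) + 1) * k₁ i) ∩ T (fun i => (2 * (m : ℤ) + 1) * k₂ i)) :=
        real_mono_of_forall_subset_edgeSet (zdGraph 3) p fun ω hω h =>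
          mem_biUnion_of_mem_annulusCrossing hm hω h
    _ ≤ ∑ k₁ ∈ F₁, (bondPercolation (zdGraph 3) p).real (⋃ k₂ ∈ F₂,
          T (fun i => (2 * (m : ℤ) + 1) * k₁ i) ∩ T (fun i => (2 * (m : ℤ) + 1) * k₂ i)) :=
        measureReal_biUnion_finset_le _ _
    _ ≤ ∑ k₁ ∈ F₁, ∑ k₂ ∈ F₂, (bondPercolation (zdGraph 3) p).real
          (T (fun i => (2 * (m : ℤ) + 1) * k₁ i) ∩ T (fun i => (2 * (m : ℤ) + 1) * k₂ i)) :=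
        Finset.sum_le_sum fun k₁ _ => measureReal_biUnion_finset_le _ _
    _ = ∑ k₁ ∈ F₁, ∑ k₂ ∈ F₂, (bondPercolation (zdGraph 3) p).real (annulusCrossing 3 m) ^ 2 :=
        Finset.sum_congr rfl fun k₁ hk₁ => Finset.sum_congr rfl fun k₂ hk₂ =>
          real_inter_shiftLinkEvent p (hfar k₁ hk₁ k₂ hk₂)
    _ = F₁.card * (F₂.card * (bondPercolation (zdGraph 3) p).real (annulusCrossing 3 m) ^ 2) := by
        rw [Finset.sum_const, Finset.sum_const, nsmul_eq_mul, nsmul_eq_mul]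
    _ ≤ 729 * (4913 * (bondPercolation (zdGraph 3) p).real (annulusCrossing 3 m) ^ 2) := by
        gcongr
    _ = _ := by ring

end StubCritCrossing

open StubCritCrossing in
/-- **Critical annuli are crossed with probability bounded below** (finite-size criterion at `p_c(ℤ³)`):
there is `ε > 0` with `P_{p_c}(B(m) ↔ ∂ⁱⁿB(2m) in B(2m)) ≥ ε` for every `m ≥ 1`. -/
theorem stub_critCrossing :
    ∃ ε : ℝ, 0 < ε ∧ ∀ m : ℕ, 1 ≤ m →
      ε ≤ (bondPercolation (zdGraph 3) (criticalProbI 3)).real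
        {ω | ∃ x ∈ box 3 m, ∃ y ∈ innerBoundary (zdGraph 3) (box 3 (2 * m)),
          ω ∈ openConnIn (↑(box 3 (2 * m)) : Set (Site 3)) x y} := by
  refine ⟨1 / (128 * (729 * 4913)), by positivity, fun m hm => ?_⟩
  set u : ℕ → ℝ := fun n => (bondPercolation (zdGraph 3) (criticalProbI 3)).real (annulusCrossing 3 n)
    with hu
  change 1 / (128 * (729 * 4913)) ≤ u m
  by_contra hlt
  push Not at hlt
  set K : ℝ := 729 * 4913 with hK
  have hK0 : (0 : ℝ) < K := by rw [hK]; norm_num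
  have hb0 : K * u m ≤ 1 / 128 := by
    rw [div_mul_eq_div_div, lt_div_iff₀ hK0] at hlt
    linarith
  have hu0 : ∀ n, 0 ≤ u n := fun n => measureReal_nonneg
  have hb1 : K * u m ≤ 1 := hb0.trans (by norm_num)
  -- doubly exponential decay along the scales `8^j m`
  have hind : ∀ j : ℕ, K * u (8 ^ j * m) ≤ (K * u m) ^ (j + 1) := by
    intro j
    induction j with
    | zero => simp
    | succ j ih =>
      have hn : 1 ≤ 8 ^ j * m := Nat.one_le_iff_ne_zero.2 (by positivity)
      have hR := real_annulusCrossing_eight_mul_le (criticalProbI 3) hn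
      have h0 : 0 ≤ K * u (8 ^ j * m) := mul_nonneg hK0.le (hu0 _)
      calc K * u (8 ^ (j + 1) * m) = K * u (8 * (8 ^ j * m)) := by rw [pow_succ]; ring_nf
        _ ≤ K * (K * u (8 ^ j * m) ^ 2) := mul_le_mul_of_nonneg_left hR hK0.le
        _ = (K * u (8 ^ j * m)) * (K * u (8 ^ j * m)) := by ring
        _ ≤ (K * u m) ^ (j + 1) * (K * u m) ^ (j + 1) := mul_le_mul ih ih h0 (h0.trans ih)
        _ ≤ (K * u m) ^ (j + 1) * (K * u m) :=
          mul_le_mul_of_nonneg_left (pow_le_of_le_one (mul_nonneg hK0.le (hu0 m)) hb1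
            (Nat.succ_ne_zero j)) (pow_nonneg (mul_nonneg hK0.le (hu0 m)) _)
        _ = (K * u m) ^ (j + 1 + 1) := by ring
  obtain ⟨j, hj⟩ := exists_pow_lt_of_lt_one (show (0 : ℝ) < K / (900 * (m : ℝ) ^ 2) by positivity)
    (show (1 / 2 : ℝ) < 1 by norm_num)
  have hA := one_le_mul_real_annulusCrossing (n := 8 ^ j * m) (Nat.one_le_iff_ne_zero.2 (by positivity))
  have hB : K * u (8 ^ j * m) ≤ (1 / 128) ^ (j + 1) :=
    (hind j).trans (pow_le_pow_left₀ (mul_nonneg hK0.le (hu0 m)) hb0 _)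
  have hD : ((8 : ℝ) ^ j) ^ 2 * (1 / 128) ^ (j + 1) = (1 / 2) ^ j * (1 / 128) := by
    rw [pow_right_comm, pow_succ (1 / 128 : ℝ) j, ← mul_assoc, ← mul_pow]; norm_num
  have hm0 : (0 : ℝ) < 900 * (m : ℝ) ^ 2 := by positivity
  have hE : K ≤ 900 * (m : ℝ) ^ 2 * (((8 : ℝ) ^ j) ^ 2 * (K * u (8 ^ j * m))) := by
    have := mul_le_mul_of_nonneg_left hA hK0.le
    push_cast at this
    nlinarith
  have hF : 900 * (m : ℝ) ^ 2 * (((8 : ℝ) ^ j) ^ 2 * (K * u (8 ^ j * m))) ≤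
      900 * (m : ℝ) ^ 2 * ((1 / 2) ^ j * (1 / 128)) := by
    rw [← hD]
    exact mul_le_mul_of_nonneg_left (mul_le_mul_of_nonneg_left hB (by positivity)) hm0.le
  have hG : 900 * (m : ℝ) ^ 2 * ((1 / 2) ^ j * (1 / 128)) <
      900 * (m : ℝ) ^ 2 * (K / (900 * (m : ℝ) ^ 2) * (1 / 128)) := by gcongr
  have hH : 900 * (m : ℝ) ^ 2 * (K / (900 * (m : ℝ) ^ 2) * (1 / 128)) = K / 128 := by
    field_simp
  linarith
 
end Summit.CriticalPhenomena.PercolationContinuityZ3.Theorems.BudgetTightness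

end
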